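import Literature.MathematicalPhysics.QuantumLattice.HubbardTTPrimeWindowCertificateConvexComb
import HarnessLib

/-!
# Convex combinations of `t–t'` window certificates with CORNER-DEPENDENT OBJECTIVES: corner
# certificates of a box in `(t', U)` for an objective AFFINE in the couplings certify the objective at
# every point of the box (the `t'`-segment rule of the Hubbard material-oracle stage S2)

Family `hubbard` (topic `MathematicalPhysics/QuantumLattice`); companion of
`HubbardTTPrimeWindowCertificateConvexComb` (hubbard-fast: corner certificates SHARING the objective `X`
combine to every barycentre). Written for the MO-S1 ↔ S2 seam of the Hubbard material oracle (cell
`pub/hubbard-downfold`, seat unc-2 standing in for the unseated `t'`-direction seat; cell `pub/hubbard-obs`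
RULING (xx) d294 L4 «MOTT-BOX» fork (ii-b) «region-valid dual»): the f-sum STIFFNESS word of the `t–t'`
model, `½ k₀^{tt'} = ½ k₀ + t'·(diagonal bond terms)` (`kinBondObsTT`, `oddMomentObsTT t' U 0`), is NOT a
shared objective across a `t'`-segment — it is AFFINE in `t'`. The convex-combination mechanism is
unchanged: the window identity is linear in every datum, so corner certificates with objectives `Xwᵢ`
(and shared `κ`, Gram basis `O`, eom family `B`, symmetry data, word lists; free `cᵢ, uᵢ, μᵢ, Λmᵢ ⪰ 0,
Yᵢ, bᵢ, dcᵢ, aᵢ`) combine under convex weights into a certificate at the barycentre for the objective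
`Σ wᵢ Xwᵢ` (`…_convexCombObj_TT'_ineq`, the proof of the shared-objective theorem verbatim with `Σ wᵢ Xwᵢ`
in place of `Xw`); for an AFFINE family `Xwᵢ = X₀ + t'ᵢ • X₁ + Uᵢ • X₂` the combined objective IS the
family's member at the barycentre (`…_convexCombObj_TT'_ineq_affine`). So two corner certificates at
`t'₁, t'₂` (same `U`, one dual vector feasible at both corners = the SAME `κ, O, B`, free Gram matrices)
bound the `t'`-dependent word at EVERY `t' ∈ [t'₁, t'₂]` by the chord of the two corner constants — «the
`t'`-interior of the box is covered by its two `t'`-corners» (barycentric weights: consumer side,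
`Summits/Ventures/CertifiedManyBodySolver/Observables/StiffnessTPrimeSegmentLeaf.lean`).

HONEST SCOPE: soundness edges only — no number, no new certificate, no claim on any ground state; the
`D₄` orbit-mean caveat of the parent theorem unchanged; whether a producer's two corner certificates SHARE
`κ, O, B` (a region-valid dual) is the producer's statement, not this file's. Everything is PROVED; no
definition, no named fact, no numerical input.

## References

* J. Wang et al., *Certifying ground-state properties of many-body systems*, PRX 14 (2024) 031006,
  §III (observable bounds under an energy constraint). [cite: WangEtAl2024, §III]
* X. Han, *Quantum many-body bootstrap*, arXiv:2006.06002 (2020), §2–§3. [cite: Han2020Bootstrap, §3]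
* O. Bratteli, A. Kishimoto, D. W. Robinson, CMP 64 (1978) 41, §3 (mean energy is linear in the
  interaction). [cite: BratteliKishimotoRobinson1978, §3 (mean energy functional)]
-/

noncomputable section

namespace Literature.MathematicalPhysics.QuantumLattice

open Matrix Finset HubbardWave0 Literature.Probability.LatticeModels ThermodynamicLimit
open Literature.MathematicalPhysics.QuantumManyBody.StateRelaxation
open _root_.Filter
open scoped _root_.Topology ComplexOrder BigOperators

/-! ### §1 The convex combination of corner certificates with corner-dependent objectives -/

/-- **Box certificate with corner-dependent objectives (point-group-reduced form).** Corner
certificates at `(t'ᵢ, Uᵢ)`, `i ∈ I`, with OBJECTIVES `Xwᵢ`, sharing `κ`, `ν`, the Gram basis `O`, the eom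
family `B`, the symmetry data `(γ, wv)` and the word lists, with free `cᵢ, uᵢ, μᵢ, Λmᵢ ⪰ 0, Yᵢ, bᵢ, dcᵢ,
aᵢ`, and convex weights `wᵢ ≥ 0`, `Σ wᵢ = 1`: for every torus-limit ground state `ω` at the barycentre
`(Σ wᵢ t'ᵢ, Σ wᵢ Uᵢ)` and the single energy hypothesis `e(t, Σ w t', Σ w U, n) ≤ Σ wᵢ uᵢ`,
`Σ wᵢ cᵢ − Σₖ ‖Σᵢ wᵢ aᵢₖ‖ + (Σ_σ Σᵢ wᵢ μᵢσ)(n/2 − ν) ≤ |S|⁻¹ Σ_{γ∈S} Re ω_{γΛ'}(Γ(d4Emb γ 0) (Σᵢ wᵢ Xwᵢ))`.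
[cite: WangEtAl2024, §III] -/
theorem InfVolFermionState.IsTorusLimitOf.re_sum_expect_d4_ge_of_window_certificates_convexCombObj_TT'_ineq
    (t : ℝ) {ι₀ : Type*} (I : Finset ι₀) (w : ι₀ → ℝ) (hw0 : ∀ i ∈ I, 0 ≤ w i)
    (hw1 : ∑ i ∈ I, w i = 1) (tp U u c : ι₀ → ℝ) (hU : ∀ i ∈ I, 0 ≤ U i)
    {n : ℝ} (hn0 : 0 ≤ n) (hn2 : n < 2) {κ : ℝ} (hκ : 0 ≤ κ)
    (hu : ThermodynamicLimit.energyDensityTT' t (∑ i ∈ I, w i * tp i) (∑ i ∈ I, w i * U i) n ≤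
      ∑ i ∈ I, w i * u i)
    {Λ Λ' : Finset (Site 2)} (hΛ : Λ ⊆ Λ') (h8 : thicken Λ 1 ⊆ Λ')
    (h0 : thicken ({0} : Finset (Site 2)) 1 ⊆ Λ') (hz : (0 : Site 2) ∈ Λ')
    {S : Finset (DihedralGroup 4)} (h1 : (1 : DihedralGroup 4) ∈ S) (hmul : ∀ a ∈ S, ∀ b ∈ S, a * b ∈ S)
    (Xw : ι₀ → FermionOp Λ') (μ : ι₀ → Fin 2 → ℝ) (ν : ℝ)
    {m : Type*} [Fintype m] [DecidableEq m] (Λm : ι₀ → Matrix m m ℂ)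
    (hΛm : ∀ i ∈ I, (Λm i).PosSemidef) (O : m → FermionOp Λ')
    {κ' : Type*} (s : Finset κ') (B : κ' → FermionOp Λ)
    {ι : Type*} (tt : Finset ι) (γ : ι → DihedralGroup 4) (hγS : ∀ l ∈ tt, γ l ∈ S) (wv : ι → Site 2)
    (hsh : ∀ l, d4ShiftSet (γ l) (wv l) Λ ⊆ Λ') (Y : ι₀ → ι → FermionOp Λ)
    {ρ : Type*} (uu : Finset ρ) (b : ι₀ → ρ → ℂ) (cw : ρ → List (Orb (PolySite Λ') × Bool))
    (hcw : ∀ j ∈ uu, ladderCharge (cw j) ≠ 0 ∨ ladderSpinCharge (cw j) ≠ 0)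
    {δ : Type*} (ah : Finset δ) (dc : ι₀ → δ → ℝ) (V : δ → FermionOp Λ')
    {κ'' : Type*} (wd : Finset κ'') (a : ι₀ → κ'' → ℂ)
    (word : κ'' → List (Orb (PolySite Λ') × Bool))
    (hcert : ∀ i ∈ I, Xw i - ((c i : ℝ) : ℂ) • (1 : FermionOp Λ') -
        ∑ σ : Fin 2, ((μ i σ : ℝ) : ℂ) • (nAt 0 hz σ - ((ν : ℝ) : ℂ) • (1 : FermionOp Λ')) -
        ((κ : ℝ) : ℂ) • (((u i : ℝ) : ℂ) • (1 : FermionOp Λ') -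
          fermionEmbed (PolySite.incl h0)
            ((hubbardTTPrimeFermionInteraction t (tp i) (U i)).meanEnergyObs 1)) =
      gramForm (Λm i) O +
        (∑ k ∈ s, ((hubbardTTPrimeFermionInteraction t (tp i) (U i)).localHamiltonian Λ' *
              fermionEmbed (PolySite.incl hΛ) (B k) -
            fermionEmbed (PolySite.incl hΛ) (B k) *
              (hubbardTTPrimeFermionInteraction t (tp i) (U i)).localHamiltonian Λ') +
          ∑ l ∈ tt, (fermionEmbed (PolySite.incl (hsh l))
              (fermionEmbed (PolySite.d4Emb (γ l) (wv l) Λ) (Y i l)) -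
            fermionEmbed (PolySite.incl hΛ) (Y i l)) +
          ∑ j ∈ uu, b i j • ladderWord (cw j)) +
        (∑ m' ∈ ah, ((dc i m' : ℝ) : ℂ) • ((V m')ᴴ - V m') + ∑ k ∈ wd, a i k • ladderWord (word k)))
    {Ls : ℕ → ℕ} (hLs : Tendsto Ls atTop atTop)
    {ψ : ∀ L, Fock (Orb (FermionTorus 2 L))}
    (hψ : ∀ j, IsGroundStateInSector
      (hubbardTorusTT' (Ls j) t (∑ i ∈ I, w i * tp i) (∑ i ∈ I, w i * U i))
      (ThermodynamicLimit.rectN n (Ls j)) 0 (ψ (Ls j)))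
    (hψ1 : ∀ j, star (ψ (Ls j)) ⬝ᵥ ψ (Ls j) = 1)
    {ω : InfVolFermionState 2} (hω : ω.IsTorusLimitOf ψ Ls) :
    ∑ i ∈ I, w i * c i - ∑ k ∈ wd, ‖∑ i ∈ I, ((w i : ℝ) : ℂ) * a i k‖ +
        (∑ σ : Fin 2, ∑ i ∈ I, w i * μ i σ) * (n / 2 - ν) ≤
      (S.card : ℝ)⁻¹ * ∑ g ∈ S,
        (ω.expect (d4ShiftSet g 0 Λ')
          (fermionEmbed (PolySite.d4Emb g 0 Λ') (∑ i ∈ I, ((w i : ℝ) : ℂ) • Xw i))).re := by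
  -- the interaction at the barycentre is the weighted sum of the corner interactions
  have hUbar : 0 ≤ ∑ i ∈ I, w i * U i :=
    Finset.sum_nonneg fun i hi => mul_nonneg (hw0 i hi) (hU i hi)
  have hΦ : ∀ X, (hubbardTTPrimeFermionInteraction t (∑ i ∈ I, w i * tp i) (∑ i ∈ I, w i * U i)).Φ X =
      ∑ i ∈ I, ((w i : ℝ) : ℂ) • (hubbardTTPrimeFermionInteraction t (tp i) (U i)).Φ X := fun X =>
    hubbardTTPrimeFermionInteraction_convexComb I w hw1 t tp U X
  have hH := FermionInteraction.localHamiltonian_of_sum hΦ Λ'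
  have hE := FermionInteraction.meanEnergyObs_of_sum hΦ 1
  -- shorthand for the corner and barycentre objects
  set Φb := hubbardTTPrimeFermionInteraction t (∑ i ∈ I, w i * tp i) (∑ i ∈ I, w i * U i) with hΦb
  set Hi : ι₀ → FermionOp Λ' := fun i =>
    (hubbardTTPrimeFermionInteraction t (tp i) (U i)).localHamiltonian Λ' with hHi
  set Ei : ι₀ → FermionOp (thicken ({0} : Finset (Site 2)) 1) := fun i =>
    (hubbardTTPrimeFermionInteraction t (tp i) (U i)).meanEnergyObs 1 with hEi
  have hH' : Φb.localHamiltonian Λ' = ∑ i ∈ I, ((w i : ℝ) : ℂ) • Hi i := hH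
  have hE' : Φb.meanEnergyObs 1 = ∑ i ∈ I, ((w i : ℝ) : ℂ) • Ei i := hE
  -- averaged data
  have hΛbar : (∑ i ∈ I, ((w i : ℝ) : ℂ) • Λm i).PosSemidef :=
    Matrix.posSemidef_sum I fun i hi => (hΛm i hi).smul (Complex.zero_le_real.2 (hw0 i hi))
  have hw1C : ∑ i ∈ I, ((w i : ℝ) : ℂ) = 1 := by
    rw [← Complex.ofReal_sum, hw1, Complex.ofReal_one]
  -- §A the left-hand sides combine
  have hl : ∑ i ∈ I, ((w i : ℝ) : ℂ) • (Xw i - ((c i : ℝ) : ℂ) • (1 : FermionOp Λ') -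
        ∑ σ : Fin 2, ((μ i σ : ℝ) : ℂ) • (nAt 0 hz σ - ((ν : ℝ) : ℂ) • (1 : FermionOp Λ')) -
        ((κ : ℝ) : ℂ) • (((u i : ℝ) : ℂ) • (1 : FermionOp Λ') - fermionEmbed (PolySite.incl h0) (Ei i))) =
      (∑ i ∈ I, ((w i : ℝ) : ℂ) • Xw i) - (((∑ i ∈ I, w i * c i : ℝ)) : ℂ) • (1 : FermionOp Λ') -
        ∑ σ : Fin 2, (((∑ i ∈ I, w i * μ i σ : ℝ)) : ℂ) • (nAt 0 hz σ - ((ν : ℝ) : ℂ) • (1 : FermionOp Λ')) -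
        ((κ : ℝ) : ℂ) • ((((∑ i ∈ I, w i * u i : ℝ)) : ℂ) • (1 : FermionOp Λ') -
          fermionEmbed (PolySite.incl h0) (Φb.meanEnergyObs 1)) := by
    have P2 : ∑ i ∈ I, ((w i : ℝ) : ℂ) • (((c i : ℝ) : ℂ) • (1 : FermionOp Λ')) =
        (((∑ i ∈ I, w i * c i : ℝ)) : ℂ) • (1 : FermionOp Λ') := by
      simp_rw [smul_smul]
      rw [← Finset.sum_smul, Complex.ofReal_sum]
      simp_rw [Complex.ofReal_mul]
    have P3 : ∑ i ∈ I, ((w i : ℝ) : ℂ) •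
          ∑ σ : Fin 2, ((μ i σ : ℝ) : ℂ) • (nAt 0 hz σ - ((ν : ℝ) : ℂ) • (1 : FermionOp Λ')) =
        ∑ σ : Fin 2, (((∑ i ∈ I, w i * μ i σ : ℝ)) : ℂ) •
          (nAt 0 hz σ - ((ν : ℝ) : ℂ) • (1 : FermionOp Λ')) := by
      simp_rw [Finset.smul_sum, smul_smul]
      rw [Finset.sum_comm]
      refine Finset.sum_congr rfl fun σ _ => ?_
      rw [← Finset.sum_smul, Complex.ofReal_sum]
      simp_rw [Complex.ofReal_mul]
    have P4 : ∑ i ∈ I, ((w i : ℝ) : ℂ) • (((κ : ℝ) : ℂ) •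
          (((u i : ℝ) : ℂ) • (1 : FermionOp Λ') - fermionEmbed (PolySite.incl h0) (Ei i))) =
        ((κ : ℝ) : ℂ) • ((((∑ i ∈ I, w i * u i : ℝ)) : ℂ) • (1 : FermionOp Λ') -
          fermionEmbed (PolySite.incl h0) (Φb.meanEnergyObs 1)) := by
      simp_rw [smul_comm ((w _ : ℝ) : ℂ) ((κ : ℝ) : ℂ)]
      rw [← Finset.smul_sum]
      congr 1
      simp_rw [smul_sub]
      rw [Finset.sum_sub_distrib]
      congr 1
      · simp_rw [smul_smul]
        rw [← Finset.sum_smul, Complex.ofReal_sum]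
        simp_rw [Complex.ofReal_mul]
      · rw [hE', map_sum]
        exact Finset.sum_congr rfl fun i _ => by rw [map_smul]
    have hdist : ∀ i ∈ I, ((w i : ℝ) : ℂ) • (Xw i - ((c i : ℝ) : ℂ) • (1 : FermionOp Λ') -
          ∑ σ : Fin 2, ((μ i σ : ℝ) : ℂ) • (nAt 0 hz σ - ((ν : ℝ) : ℂ) • (1 : FermionOp Λ')) -
          ((κ : ℝ) : ℂ) • (((u i : ℝ) : ℂ) • (1 : FermionOp Λ') - fermionEmbed (PolySite.incl h0) (Ei i))) =
        ((w i : ℝ) : ℂ) • Xw i - ((w i : ℝ) : ℂ) • (((c i : ℝ) : ℂ) • (1 : FermionOp Λ')) -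
          ((w i : ℝ) : ℂ) • ∑ σ : Fin 2, ((μ i σ : ℝ) : ℂ) • (nAt 0 hz σ - ((ν : ℝ) : ℂ) • (1 : FermionOp Λ')) -
          ((w i : ℝ) : ℂ) • (((κ : ℝ) : ℂ) •
            (((u i : ℝ) : ℂ) • (1 : FermionOp Λ') - fermionEmbed (PolySite.incl h0) (Ei i))) := by
      intro i _
      rw [smul_sub, smul_sub, smul_sub]
    rw [Finset.sum_congr rfl hdist, Finset.sum_sub_distrib, Finset.sum_sub_distrib,
      Finset.sum_sub_distrib, P2, P3, P4]
  -- §B the right-hand sides combine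
  have hr : ∑ i ∈ I, ((w i : ℝ) : ℂ) • (gramForm (Λm i) O +
        (∑ k ∈ s, (Hi i * fermionEmbed (PolySite.incl hΛ) (B k) -
            fermionEmbed (PolySite.incl hΛ) (B k) * Hi i) +
          ∑ l ∈ tt, (fermionEmbed (PolySite.incl (hsh l))
              (fermionEmbed (PolySite.d4Emb (γ l) (wv l) Λ) (Y i l)) -
            fermionEmbed (PolySite.incl hΛ) (Y i l)) +
          ∑ j ∈ uu, b i j • ladderWord (cw j)) +
        (∑ m' ∈ ah, ((dc i m' : ℝ) : ℂ) • ((V m')ᴴ - V m') + ∑ k ∈ wd, a i k • ladderWord (word k))) =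
      gramForm (∑ i ∈ I, ((w i : ℝ) : ℂ) • Λm i) O +
        (∑ k ∈ s, (Φb.localHamiltonian Λ' * fermionEmbed (PolySite.incl hΛ) (B k) -
            fermionEmbed (PolySite.incl hΛ) (B k) * Φb.localHamiltonian Λ') +
          ∑ l ∈ tt, (fermionEmbed (PolySite.incl (hsh l))
              (fermionEmbed (PolySite.d4Emb (γ l) (wv l) Λ) (∑ i ∈ I, ((w i : ℝ) : ℂ) • Y i l)) -
            fermionEmbed (PolySite.incl hΛ) (∑ i ∈ I, ((w i : ℝ) : ℂ) • Y i l)) +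
          ∑ j ∈ uu, (∑ i ∈ I, ((w i : ℝ) : ℂ) * b i j) • ladderWord (cw j)) +
        (∑ m' ∈ ah, (((∑ i ∈ I, w i * dc i m' : ℝ)) : ℂ) • ((V m')ᴴ - V m') +
          ∑ k ∈ wd, (∑ i ∈ I, ((w i : ℝ) : ℂ) * a i k) • ladderWord (word k)) := by
    have Q1 : ∑ i ∈ I, ((w i : ℝ) : ℂ) • gramForm (Λm i) O =
        gramForm (∑ i ∈ I, ((w i : ℝ) : ℂ) • Λm i) O := (gramForm_sum_smul I _ Λm O).symm
    have Q2 : ∑ i ∈ I, ((w i : ℝ) : ℂ) • ∑ k ∈ s, (Hi i * fermionEmbed (PolySite.incl hΛ) (B k) -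
          fermionEmbed (PolySite.incl hΛ) (B k) * Hi i) =
        ∑ k ∈ s, (Φb.localHamiltonian Λ' * fermionEmbed (PolySite.incl hΛ) (B k) -
          fermionEmbed (PolySite.incl hΛ) (B k) * Φb.localHamiltonian Λ') := by
      simp_rw [Finset.smul_sum]
      rw [Finset.sum_comm]
      refine Finset.sum_congr rfl fun k _ => ?_
      have e1 : ∀ i, ((w i : ℝ) : ℂ) • (Hi i * fermionEmbed (PolySite.incl hΛ) (B k)) =
          (((w i : ℝ) : ℂ) • Hi i) * fermionEmbed (PolySite.incl hΛ) (B k) := fun i =>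
        (smul_mul_assoc _ _ _).symm
      have e2 : ∀ i, ((w i : ℝ) : ℂ) • (fermionEmbed (PolySite.incl hΛ) (B k) * Hi i) =
          fermionEmbed (PolySite.incl hΛ) (B k) * (((w i : ℝ) : ℂ) • Hi i) := fun i =>
        (mul_smul_comm _ _ _).symm
      simp_rw [smul_sub, e1, e2]
      rw [Finset.sum_sub_distrib, ← Finset.sum_mul, ← Finset.mul_sum, ← hH']
    have Q3 : ∑ i ∈ I, ((w i : ℝ) : ℂ) • ∑ l ∈ tt, (fermionEmbed (PolySite.incl (hsh l))
          (fermionEmbed (PolySite.d4Emb (γ l) (wv l) Λ) (Y i l)) - fermionEmbed (PolySite.incl hΛ) (Y i l)) =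
        ∑ l ∈ tt, (fermionEmbed (PolySite.incl (hsh l))
          (fermionEmbed (PolySite.d4Emb (γ l) (wv l) Λ) (∑ i ∈ I, ((w i : ℝ) : ℂ) • Y i l)) -
          fermionEmbed (PolySite.incl hΛ) (∑ i ∈ I, ((w i : ℝ) : ℂ) • Y i l)) := by
      simp_rw [Finset.smul_sum]
      rw [Finset.sum_comm]
      refine Finset.sum_congr rfl fun l _ => ?_
      simp_rw [smul_sub]
      rw [Finset.sum_sub_distrib, map_sum, map_sum, map_sum]
      congr 1
      · exact Finset.sum_congr rfl fun i _ => by rw [map_smul, map_smul]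
      · exact Finset.sum_congr rfl fun i _ => by rw [map_smul]
    have Q4 : ∑ i ∈ I, ((w i : ℝ) : ℂ) • ∑ j ∈ uu, b i j • ladderWord (cw j) =
        ∑ j ∈ uu, (∑ i ∈ I, ((w i : ℝ) : ℂ) * b i j) • ladderWord (cw j) := by
      simp_rw [Finset.smul_sum, smul_smul]
      rw [Finset.sum_comm]
      exact Finset.sum_congr rfl fun j _ => by rw [Finset.sum_smul]
    have Q5 : ∑ i ∈ I, ((w i : ℝ) : ℂ) • ∑ m' ∈ ah, ((dc i m' : ℝ) : ℂ) • ((V m')ᴴ - V m') =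
        ∑ m' ∈ ah, (((∑ i ∈ I, w i * dc i m' : ℝ)) : ℂ) • ((V m')ᴴ - V m') := by
      simp_rw [Finset.smul_sum, smul_smul]
      rw [Finset.sum_comm]
      refine Finset.sum_congr rfl fun m' _ => ?_
      rw [← Finset.sum_smul, Complex.ofReal_sum]
      simp_rw [Complex.ofReal_mul]
    have Q6 : ∑ i ∈ I, ((w i : ℝ) : ℂ) • ∑ k ∈ wd, a i k • ladderWord (word k) =
        ∑ k ∈ wd, (∑ i ∈ I, ((w i : ℝ) : ℂ) * a i k) • ladderWord (word k) := by
      simp_rw [Finset.smul_sum, smul_smul]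
      rw [Finset.sum_comm]
      exact Finset.sum_congr rfl fun k _ => by rw [Finset.sum_smul]
    simp only [smul_add, Finset.sum_add_distrib]
    rw [Q1, Q2, Q3, Q4, Q5, Q6]
  -- §C the combined identity, and the tree theorem at the barycentre
  have hs : ∑ i ∈ I, ((w i : ℝ) : ℂ) • (Xw i - ((c i : ℝ) : ℂ) • (1 : FermionOp Λ') -
        ∑ σ : Fin 2, ((μ i σ : ℝ) : ℂ) • (nAt 0 hz σ - ((ν : ℝ) : ℂ) • (1 : FermionOp Λ')) -
        ((κ : ℝ) : ℂ) • (((u i : ℝ) : ℂ) • (1 : FermionOp Λ') - fermionEmbed (PolySite.incl h0) (Ei i))) =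
      ∑ i ∈ I, ((w i : ℝ) : ℂ) • (gramForm (Λm i) O +
        (∑ k ∈ s, (Hi i * fermionEmbed (PolySite.incl hΛ) (B k) -
            fermionEmbed (PolySite.incl hΛ) (B k) * Hi i) +
          ∑ l ∈ tt, (fermionEmbed (PolySite.incl (hsh l))
              (fermionEmbed (PolySite.d4Emb (γ l) (wv l) Λ) (Y i l)) -
            fermionEmbed (PolySite.incl hΛ) (Y i l)) +
          ∑ j ∈ uu, b i j • ladderWord (cw j)) +
        (∑ m' ∈ ah, ((dc i m' : ℝ) : ℂ) • ((V m')ᴴ - V m') + ∑ k ∈ wd, a i k • ladderWord (word k))) :=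
    Finset.sum_congr rfl fun i hi => by rw [hcert i hi]
  rw [hl, hr] at hs
  have h := hω.re_sum_expect_d4_ge_of_window_certificate_TT'_ineq t (∑ i ∈ I, w i * tp i) hUbar hn0
    hn2 hκ hu hΛ h8 h0 hz h1 hmul (∑ i ∈ I, ((w i : ℝ) : ℂ) • Xw i) (fun σ => ∑ i ∈ I, w i * μ i σ) ν hΛbar O s B
    tt γ hγS wv hsh
    (fun l => ∑ i ∈ I, ((w i : ℝ) : ℂ) • Y i l) uu (fun j => ∑ i ∈ I, ((w i : ℝ) : ℂ) * b i j) cw hcw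
    ah (fun m' => ∑ i ∈ I, w i * dc i m') V wd (fun k => ∑ i ∈ I, ((w i : ℝ) : ℂ) * a i k) word hs
    hLs hψ hψ1
  simpa using h

/-! ### §2 Affine objective families: the combined objective is the family's member at the barycentre -/

/-- **Convex combination of an affine objective family.** For `Σ wᵢ = 1`:
`Σᵢ wᵢ • (X₀ + t'ᵢ • X₁ + Uᵢ • X₂) = X₀ + (Σ wᵢ t'ᵢ) • X₁ + (Σ wᵢ Uᵢ) • X₂`. [cite: Han2020Bootstrap, §3] -/
theorem sum_smul_affineObjective {𝓐 : Type*} [AddCommGroup 𝓐] [Module ℂ 𝓐] {ι₀ : Type*} (I : Finset ι₀)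
    (w tp U : ι₀ → ℝ) (hw1 : ∑ i ∈ I, w i = 1) (X₀ X₁ X₂ : 𝓐) :
    ∑ i ∈ I, ((w i : ℝ) : ℂ) • (X₀ + ((tp i : ℝ) : ℂ) • X₁ + ((U i : ℝ) : ℂ) • X₂) =
      X₀ + (((∑ i ∈ I, w i * tp i : ℝ)) : ℂ) • X₁ + (((∑ i ∈ I, w i * U i : ℝ)) : ℂ) • X₂ := by
  have hw1C : ∑ i ∈ I, ((w i : ℝ) : ℂ) = 1 := by rw [← Complex.ofReal_sum, hw1, Complex.ofReal_one]
  simp only [smul_add, smul_smul, Finset.sum_add_distrib, ← Finset.sum_smul]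
  rw [hw1C, one_smul, Complex.ofReal_sum, Complex.ofReal_sum]
  simp_rw [Complex.ofReal_mul]

/-- **Box certificate for an AFFINE objective family** `Xwᵢ = X₀ + t'ᵢ • X₁ + Uᵢ • X₂` (e.g. the `t–t'` f-sum
word, `X₂ = 0`): under the hypotheses of `…_convexCombObj_TT'_ineq` the conclusion bounds the orbit mean of
the family's member AT THE BARYCENTRE, `X₀ + (Σ wᵢ t'ᵢ) • X₁ + (Σ wᵢ Uᵢ) • X₂`. [cite: WangEtAl2024, §III] -/
theorem InfVolFermionState.IsTorusLimitOf.re_sum_expect_d4_ge_of_window_certificates_convexCombObj_TT'_ineq_affine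
    (t : ℝ) {ι₀ : Type*} (I : Finset ι₀) (w : ι₀ → ℝ) (hw0 : ∀ i ∈ I, 0 ≤ w i)
    (hw1 : ∑ i ∈ I, w i = 1) (tp U u c : ι₀ → ℝ) (hU : ∀ i ∈ I, 0 ≤ U i)
    {n : ℝ} (hn0 : 0 ≤ n) (hn2 : n < 2) {κ : ℝ} (hκ : 0 ≤ κ)
    (hu : ThermodynamicLimit.energyDensityTT' t (∑ i ∈ I, w i * tp i) (∑ i ∈ I, w i * U i) n ≤
      ∑ i ∈ I, w i * u i)
    {Λ Λ' : Finset (Site 2)} (hΛ : Λ ⊆ Λ') (h8 : thicken Λ 1 ⊆ Λ')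
    (h0 : thicken ({0} : Finset (Site 2)) 1 ⊆ Λ') (hz : (0 : Site 2) ∈ Λ')
    {S : Finset (DihedralGroup 4)} (h1 : (1 : DihedralGroup 4) ∈ S) (hmul : ∀ a ∈ S, ∀ b ∈ S, a * b ∈ S)
    (X₀ X₁ X₂ : FermionOp Λ') (μ : ι₀ → Fin 2 → ℝ) (ν : ℝ)
    {m : Type*} [Fintype m] [DecidableEq m] (Λm : ι₀ → Matrix m m ℂ)
    (hΛm : ∀ i ∈ I, (Λm i).PosSemidef) (O : m → FermionOp Λ')
    {κ' : Type*} (s : Finset κ') (B : κ' → FermionOp Λ)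
    {ι : Type*} (tt : Finset ι) (γ : ι → DihedralGroup 4) (hγS : ∀ l ∈ tt, γ l ∈ S) (wv : ι → Site 2)
    (hsh : ∀ l, d4ShiftSet (γ l) (wv l) Λ ⊆ Λ') (Y : ι₀ → ι → FermionOp Λ)
    {ρ : Type*} (uu : Finset ρ) (b : ι₀ → ρ → ℂ) (cw : ρ → List (Orb (PolySite Λ') × Bool))
    (hcw : ∀ j ∈ uu, ladderCharge (cw j) ≠ 0 ∨ ladderSpinCharge (cw j) ≠ 0)
    {δ : Type*} (ah : Finset δ) (dc : ι₀ → δ → ℝ) (V : δ → FermionOp Λ')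
    {κ'' : Type*} (wd : Finset κ'') (a : ι₀ → κ'' → ℂ)
    (word : κ'' → List (Orb (PolySite Λ') × Bool))
    (hcert : ∀ i ∈ I, (X₀ + ((tp i : ℝ) : ℂ) • X₁ + ((U i : ℝ) : ℂ) • X₂) - ((c i : ℝ) : ℂ) • (1 : FermionOp Λ') -
        ∑ σ : Fin 2, ((μ i σ : ℝ) : ℂ) • (nAt 0 hz σ - ((ν : ℝ) : ℂ) • (1 : FermionOp Λ')) -
        ((κ : ℝ) : ℂ) • (((u i : ℝ) : ℂ) • (1 : FermionOp Λ') -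
          fermionEmbed (PolySite.incl h0)
            ((hubbardTTPrimeFermionInteraction t (tp i) (U i)).meanEnergyObs 1)) =
      gramForm (Λm i) O +
        (∑ k ∈ s, ((hubbardTTPrimeFermionInteraction t (tp i) (U i)).localHamiltonian Λ' *
              fermionEmbed (PolySite.incl hΛ) (B k) -
            fermionEmbed (PolySite.incl hΛ) (B k) *
              (hubbardTTPrimeFermionInteraction t (tp i) (U i)).localHamiltonian Λ') +
          ∑ l ∈ tt, (fermionEmbed (PolySite.incl (hsh l))
              (fermionEmbed (PolySite.d4Emb (γ l) (wv l) Λ) (Y i l)) -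
            fermionEmbed (PolySite.incl hΛ) (Y i l)) +
          ∑ j ∈ uu, b i j • ladderWord (cw j)) +
        (∑ m' ∈ ah, ((dc i m' : ℝ) : ℂ) • ((V m')ᴴ - V m') + ∑ k ∈ wd, a i k • ladderWord (word k)))
    {Ls : ℕ → ℕ} (hLs : Tendsto Ls atTop atTop)
    {ψ : ∀ L, Fock (Orb (FermionTorus 2 L))}
    (hψ : ∀ j, IsGroundStateInSector
      (hubbardTorusTT' (Ls j) t (∑ i ∈ I, w i * tp i) (∑ i ∈ I, w i * U i))
      (ThermodynamicLimit.rectN n (Ls j)) 0 (ψ (Ls j)))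
    (hψ1 : ∀ j, star (ψ (Ls j)) ⬝ᵥ ψ (Ls j) = 1)
    {ω : InfVolFermionState 2} (hω : ω.IsTorusLimitOf ψ Ls) :
    ∑ i ∈ I, w i * c i - ∑ k ∈ wd, ‖∑ i ∈ I, ((w i : ℝ) : ℂ) * a i k‖ +
        (∑ σ : Fin 2, ∑ i ∈ I, w i * μ i σ) * (n / 2 - ν) ≤
      (S.card : ℝ)⁻¹ * ∑ g ∈ S,
        (ω.expect (d4ShiftSet g 0 Λ')
          (fermionEmbed (PolySite.d4Emb g 0 Λ')
            (X₀ + (((∑ i ∈ I, w i * tp i : ℝ)) : ℂ) • X₁ + (((∑ i ∈ I, w i * U i : ℝ)) : ℂ) • X₂))).re := by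
  have h := hω.re_sum_expect_d4_ge_of_window_certificates_convexCombObj_TT'_ineq t I w hw0 hw1 tp U u c hU
    hn0 hn2 hκ hu hΛ h8 h0 hz h1 hmul (fun i => X₀ + ((tp i : ℝ) : ℂ) • X₁ + ((U i : ℝ) : ℂ) • X₂) μ ν Λm
    hΛm O s B tt γ hγS wv hsh Y uu b cw hcw ah dc V wd a word hcert hLs hψ hψ1
  rwa [sum_smul_affineObjective I w tp U hw1 X₀ X₁ X₂] at h


end Literature.MathematicalPhysics.QuantumLattice

end
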